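import Literature.AlgebraicGeometry.Frobenioids.RealificationDataCanonicalWeak
import Literature.AnabelianGeometry.EtaleTheta.RealifiedDivisorMonoidsOfRlfR

/-!
# [EtTh] Definition 3.6 (i): the realified data CONSTRUCTED from the data of Definition 3.3 (iii) over the
# WEAK vocabulary — `RealifiedDivisorMonoids.ofRlfZWeak` (monoid type `ℤ`) and `ofRlfRWeak` (type `ℝ`)

Mochizuki, *The étale theta function …*, Publ. RIMS **45** (2009), Def. 3.6 (i), PDF p.76 (printed 302)
[cite: MochizukiEtTh2009, Def 3.6 p.76]: "In the notation of Definition 3.3 [(iii): the data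
`(Φ₀, B₀, B₀ → Φ₀^gp, F₀ ⊆ B₀)`, with `Φ₀^birat`, `Φ₀^cnst ⊆ Φ₀^gp`], write `Φ₀^ℝ := Φ₀^rlf` — where
`Φ₀^rlf` is as in [FrdI], Definition 2.4, (i) [cf. Proposition 3.4, (i)] …; `ℝ·Φ₀^birat ⊆ (Φ₀^ℝ)^gp`,
`ℝ·Φ₀^cnst ⊆ (Φ₀^ℝ)^gp`" (the displayed inclusions, with the pointer to [FrdI]) "… `B₀^Λ` for `B₀`
(resp. `B₀^pf`; `ℝ·Φ₀^birat`) if `Λ = ℤ` (resp. `ℚ`; `ℝ`), `F₀^Λ ⊆ B₀^Λ` for `F₀` (resp. `F₀^pf`;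
`ℝ·Φ₀^cnst`)"; Def. 3.6 (iii), p.77: elements of `Φ₀^ℝ` "arising from" non-cuspidal (resp. cuspidal)
log-divisors.  The reading of `ℝ·(−)` as "the `ℝ`-vector subspace of `(Φ^rlf)^gp` generated by" is
[FrdI] Prop. 5.3, p.103 ("`(ℝ · Φ^birat)(A_D)` is the `ℝ`-vector subspace of `(Φ^rlf)^gp(A_D)` generated by
`Φ^birat(A_D)`") [cite: MochizukiFrdI2008, Prop. 5.3 p.103], to which Def. 3.6 (i) points via [FrdI]
Def. 2.4 (i) (ref-d D8-F6: the display is [EtTh]'s, the generating gloss is [FrdI]'s).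

WEAK-VOCABULARY TWIN of `RealifiedDivisorMonoidsOfRlf.lean` (`ofRlfZ`, p412382) and
`RealifiedDivisorMonoidsOfRlfR.lean` (`ofRlfR`, p412754), same seat.  Those constructors take the printed
Prop. 3.4 (i) "`Φ₀(Y^log)` is perf-factorial" for EVERY `Y`; cell finding F-L2d2-1 (abc-iut-L2-d2; kernel
witness `PerfFactorialProductCounterexample.not_isPerfFactorial_multiplicative_pi_nat`): at tempered
coverings whose `Δ^fil`-closures have infinitely many special-fibre components (`Ÿ`, `Z_∞` — exactly the
objects of the bi-Kummer theory of §§4–5) condition (d) of [FrdI] Def. 2.4 (i) fails for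
`Φ₀(Y^log) ⊇ ∏_j ℤ_{≥0}`, so `ofRlfZ dm hpf` is VACUOUS there.  The cell's repaired vocabulary is
abc-iut-L2-t3's `treeMonoidVocabWeak` (`FrdIVocabularyWeak.lean`; F-L2d2-2): "perf-factorial" :=
`IsPerfFactorialCof` (weak (a)(b)(c)+(d_ord)+(d_res) AND cofinal perfection — Mochizuki's sentence of the
proof of Lemma 3.5), "realification" := `IsRealificationViaWeak`.  THIS FILE assembles, exactly as the
strong files do, the weak realification functor (`rlfFunctorWeak`, `RealificationFunctorWeak.lean`), THE
weak realification data (`RealificationData.canonicalWeak`: the `ℝ`-vector spaces `(Φ₀(Y)^rlf)^gp`,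
`RealificationDataCanonicalWeak.lean`) and abc-iut-L1-t5's `ℝ`-span `RealificationData.realSpan` into:

* `ofRlfZWeak dm hpf : RealifiedDivisorMonoids treeMonoidVocabWeak` (`Λ = ℤ`, the case §§4–5 use:
  `Φ₀^ℝ := Φ₀^rlf`, `B₀^ℤ := B₀`, `F₀^ℤ := F₀`, `B₀^ℤ → (Φ₀^ℝ)^gp := ι ∘ (B₀ → Φ₀^gp)`, `ℝ·Φ₀^cnst :=`
  the `ℝ`-span of `Φ₀^cnst`, non-cuspidal / cuspidal parts of `Φ₀^ℝ(Y)` in the SUPPORT reading of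
  Def. 3.6 (iii) / Def. 3.1 (i) as in `ofRlfZ`);
* `ofRlfRWeak dm hpf` (`Λ = ℝ`: `B₀^ℝ := ℝ·Φ₀^birat`, `F₀^ℝ := ℝ·Φ₀^cnst`),

for `hpf : ∀ Y, IsPerfFactorialCof (Φ₀ Y)` — every axiom of the interface PROVED (naturality,
realification via the weak vocabulary, `B₀^Λ` group-like, `F₀^Λ ↦ ℝ·Φ₀^cnst`, pull-back stability and
root-closedness of `ℝ·Φ₀^cnst`, `Φ₀^cnst ⊆ ℝ·Φ₀^cnst`, compatibility with the (non-)cuspidal parts).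
Seat abc-iut-L6-t12 (cell abc-iut; F-L2d2-1 / F-L2d2-2 repair chain, split with abc-iut-L2-d2
2026-08-26T03:42Z, piece (E)).  HONEST FRAMING: a construction over an abstract Def. 3.3 (iii) datum; nothing
here asserts the data exist for an actual curve; nothing here bears on [IUTchIII] Cor. 3.12.
-/

noncomputable section

namespace Literature.AnabelianGeometry.EtaleTheta

open CategoryTheory Opposite Literature.AlgebraicGeometry.Frobenioids

universe u v w

/-! ### `ℝ`-spans are monotone (generic over the realification data) -/

namespace RealificationDataLemmas

variable {D : Type u} [Category.{v} D] {Φ : Dᵒᵖ ⥤ CommMonCat.{w}} (R : RealificationData Φ)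

/-- `Ψ ⊆ Ψ'` objectwise ⇒ `ℝ·Ψ ⊆ ℝ·Ψ'` (spans are monotone). [cite: MochizukiFrdI2008, Prop. 5.3 p.103] -/
theorem realSpan_mono {Ψ Ψ' : GpSubfunctor Φ} (X : D) (hle : Ψ.carrier X ≤ Ψ'.carrier X) :
    (R.realSpan Ψ).carrier X ≤ (R.realSpan Ψ').carrier X := by
  apply Subgroup.closure_mono
  rintro _ ⟨r, c, hc, rfl⟩
  exact ⟨r, c, hle hc, rfl⟩

end RealificationDataLemmas

namespace RealifiedDivisorMonoids

variable {D₀ : Type u} [Category.{v} D₀] (dm : DivisorMonoids.{u, v, w} D₀)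
  (hpf : ∀ Y : D₀ᵒᵖ, IsPerfFactorialCof (dm.Φ₀.obj Y))

/-- THE weak realification data of `Φ₀` ([FrdI] Prop. 5.3 for the monoid `Φ₀` with weakly perf-factorial
values with cofinal perfections: `Φ₀^rlf`, `Φ₀^pf → Φ₀^rlf`, `ℝ ↷ (Φ₀^rlf)^gp`).
[cite: MochizukiEtTh2009, Def 3.6 p.76] -/
abbrev realDataWeak : RealificationData dm.Φ₀ := RealificationData.canonicalWeak dm.Φ₀ hpf

/-- The groupified natural map of THE weak realification data is `gpMap` of `Φ₀(Y) → Φ₀(Y)^rlf`.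
[cite: MochizukiEtTh2009, Def 3.6 p.76] -/
theorem toRlfGp_realDataWeak_eq (X : D₀) :
    (realDataWeak dm hpf).toRlfGp X = gpMap ((toRlfNatTransWeak dm.Φ₀ hpf).app (op X)).hom := by
  apply MonGp.hom_ext
  intro a
  rw [RealificationData.toRlfGp, MonGp.map_of, RealificationData.canonicalWeak_toRlf_app_hom]
  exact (gpMap_of ((toRlfNatTransWeak dm.Φ₀ hpf).app (op X)).hom a).symm

/-- The submonoid of `M^rlf` (weak `M`) of the elements SUPPORTED in a given set `S` of primes (support
taken in `M^rlf ⊆ M^rlf_factor = ∏_𝔭 M^rlf_𝔭`, [FrdI] Def. 2.4 (i)(c)); closed under products since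
`supp(ab) ⊆ supp(a) ∪ supp(b)`. [cite: MochizukiFrdI2008, Def. 2.4 (i) p.48] -/
def rlfSuppInWeak {M : Type w} [CommMonoid M] (h : IsPerfFactorialWeak M)
    (S : Set (Primes (Perfection M))) : Submonoid h.Rlf where
  carrier := {x | supp (x : RlfFactor M) ⊆ S}
  mul_mem' {x y} hx hy :=
    (supp_mul_subset (x : RlfFactor M) (y : RlfFactor M)).trans (Set.union_subset hx hy)
  one_mem' := fun _ h𝔮 => (h𝔮 rfl).elim

/-- Membership in `rlfSuppInWeak`. [cite: MochizukiFrdI2008, Def. 2.4 (i) p.48] -/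
theorem mem_rlfSuppInWeak_iff {M : Type w} [CommMonoid M] (h : IsPerfFactorialWeak M)
    (S : Set (Primes (Perfection M))) (x : h.Rlf) :
    x ∈ rlfSuppInWeak h S ↔ supp (x : RlfFactor M) ⊆ S :=
  Iff.rfl

/-- The set of primes of `Φ₀(Y)` "arising from" a given set `N ⊆ Φ₀(Y)` of log-divisors (weak `Φ₀(Y)`):
the union of the supports, in `Φ₀(Y)^rlf`, of the images `ι(a)`, `a ∈ N` (for `N =` the non-cuspidal,
resp. cuspidal, elements: the primes lying in the special fibre, resp. in the divisor of cusps,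
Def. 3.1 (i) p.70). [cite: MochizukiEtTh2009, Def 3.6 p.77] -/
def toRSuppOfWeak (Y : D₀ᵒᵖ) (N : Submonoid (dm.Φ₀.obj Y)) :
    Set (Primes (Perfection (dm.Φ₀.obj Y))) :=
  ⋃ a ∈ (N : Set (dm.Φ₀.obj Y)),
    supp ((hpf Y).weak.realification.subtype (((toRlfNatTransWeak dm.Φ₀ hpf).app Y).hom a))

/-- The image `ι(a)` of `a ∈ N` is supported in the primes arising from `N` (weak `Φ₀(Y)`).
[cite: MochizukiEtTh2009, Def 3.6 p.77] -/
theorem supp_toR_subset_toRSuppOfWeak (Y : D₀ᵒᵖ) {N : Submonoid (dm.Φ₀.obj Y)} {a : dm.Φ₀.obj Y}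
    (ha : a ∈ N) :
    supp ((hpf Y).weak.realification.subtype (((toRlfNatTransWeak dm.Φ₀ hpf).app Y).hom a)) ⊆
      toRSuppOfWeak dm hpf Y N :=
  Set.subset_biUnion_of_mem
    (u := fun a : dm.Φ₀.obj Y =>
      supp ((hpf Y).weak.realification.subtype (((toRlfNatTransWeak dm.Φ₀ hpf).app Y).hom a))) ha

/-- **Definition 3.6 (i) for the monoid type `Λ = ℤ` over the WEAK vocabulary, CONSTRUCTED** from the
Def. 3.3 (iii) data `dm` and the repaired Prop. 3.4 (i) ("`Φ₀(Y)` weakly perf-factorial with cofinal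
perfection", `IsPerfFactorialCof` — satisfiable at `Ÿ`, `Z_∞`): `Φ₀^ℝ := Φ₀^rlf` (the weak realification
functor), `B₀^ℤ := B₀`, `F₀^ℤ := F₀`, `B₀^ℤ → (Φ₀^ℝ)^gp := ι ∘ (B₀ → Φ₀^gp)`, `ℝ·Φ₀^cnst :=` the `ℝ`-span of
`Φ₀^cnst` in `(Φ₀^ℝ)^gp`, and the non-cuspidal / cuspidal parts of `Φ₀^ℝ(Y)` (Def. 3.6 (iii), p.77) := the
elements of `Φ₀(Y)^rlf` supported in the primes arising from the non-cuspidal / cuspidal elements of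
`Φ₀(Y)`.  All of abc-iut-L2-t3's Def. 3.6 (i) axioms are PROVED, with `V = treeMonoidVocabWeak`.
[cite: MochizukiEtTh2009, Def 3.6 p.76] -/
def ofRlfZWeak : RealifiedDivisorMonoids (D₀ := D₀) treeMonoidVocabWeak.{w} where
  toDivisorMonoids := dm
  Λ := MonoidType.Z
  ΦR := rlfFunctorWeak dm.Φ₀ hpf
  toR Y := ((toRlfNatTransWeak dm.Φ₀ hpf).app Y).hom
  toR_natural f x := (rlfMapWeak_toRealification_of dm.Φ₀ hpf f x).symm
  isRealification Y := isRealificationViaWeak_toRealification (hpf Y).weak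
  BΛ := dm.B₀
  isUnit_BΛ := dm.isUnit_B₀
  divΛ Y := (gpMap ((toRlfNatTransWeak dm.Φ₀ hpf).app Y).hom).comp (dm.div₀ Y)
  divΛ_natural {Y Y'} f b := by
    have hcomp : ((toRlfNatTransWeak dm.Φ₀ hpf).app Y').hom.comp (dm.Φ₀.map f).hom =
        ((rlfFunctorWeak dm.Φ₀ hpf).map f).hom.comp ((toRlfNatTransWeak dm.Φ₀ hpf).app Y).hom :=
      MonoidHom.ext fun x => (rlfMapWeak_toRealification_of dm.Φ₀ hpf f x).symm
    change gpMap ((toRlfNatTransWeak dm.Φ₀ hpf).app Y').hom (dm.div₀ Y' ((dm.B₀.map f).hom b)) =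
      gpMap ((rlfFunctorWeak dm.Φ₀ hpf).map f).hom
        (gpMap ((toRlfNatTransWeak dm.Φ₀ hpf).app Y).hom (dm.div₀ Y b))
    rw [dm.div₀_natural f b, ← gpMap_comp_apply'', ← gpMap_comp_apply'', hcomp]
  FΛ := dm.F₀
  FΛ_map := dm.F₀_map
  cnstR Y := ((realDataWeak dm hpf).realSpan dm.cnstGp).carrier (unop Y)
  cnstR_map {Y Y'} f x hx := by
    have h := ((realDataWeak dm hpf).realSpan dm.cnstGp).pull_mem f.unop hx
    rwa [pullGp, ← gpMap_eq_monGpMap] at h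
  divΛ_mem_cnstR Y b hb := by
    change gpMap ((toRlfNatTransWeak dm.Φ₀ hpf).app Y).hom (dm.div₀ Y b) ∈
      ((realDataWeak dm hpf).realSpan dm.cnstGp).carrier (unop Y)
    rw [← toRlfGp_realDataWeak_eq]
    exact (realDataWeak dm hpf).toRlfGp_mem_realSpan dm.cnstGp (unop Y)
      (dm.mem_cnstGp_of_mem_cnst (unop Y) ⟨b, hb, rfl⟩)
  cnstR_root Y g n hg := RealificationDataLemmas.mem_realSpan_of_pow_mem _ _ (unop Y) n.pos hg
  cnst_le_cnstR Y b hb := by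
    change gpMap ((toRlfNatTransWeak dm.Φ₀ hpf).app Y).hom (dm.div₀ Y b) ∈
      ((realDataWeak dm hpf).realSpan dm.cnstGp).carrier (unop Y)
    rw [← toRlfGp_realDataWeak_eq]
    exact (realDataWeak dm hpf).toRlfGp_mem_realSpan dm.cnstGp (unop Y)
      (dm.mem_cnstGp_of_mem_cnst (unop Y) ⟨b, hb, rfl⟩)
  ncspR Y := rlfSuppInWeak (hpf Y).weak (toRSuppOfWeak dm hpf Y (dm.ncsp₀ Y))
  cspR Y := rlfSuppInWeak (hpf Y).weak (toRSuppOfWeak dm hpf Y (dm.csp₀ Y))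
  toR_ncsp Y x hx := supp_toR_subset_toRSuppOfWeak dm hpf Y hx
  toR_csp Y x hx := supp_toR_subset_toRSuppOfWeak dm hpf Y hx

/-! ### What the constructor returns (definitional unfoldings for consumers) -/

/-- `ofRlfZWeak` keeps the Def. 3.3 (iii) data. [cite: MochizukiEtTh2009, Def 3.6 p.76] -/
@[simp] theorem ofRlfZWeak_toDivisorMonoids : (ofRlfZWeak dm hpf).toDivisorMonoids = dm := rfl

/-- The monoid type of `ofRlfZWeak` is `ℤ`. [cite: MochizukiEtTh2009, Def 3.6 p.76] -/
@[simp] theorem ofRlfZWeak_Λ : (ofRlfZWeak dm hpf).Λ = MonoidType.Z := rfl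

/-- `Φ₀^ℝ` of `ofRlfZWeak` is the weak realification functor `Φ₀^rlf`. [cite: MochizukiEtTh2009, Def 3.6 p.76] -/
@[simp] theorem ofRlfZWeak_ΦR : (ofRlfZWeak dm hpf).ΦR = rlfFunctorWeak dm.Φ₀ hpf := rfl

/-- `Φ₀ → Φ₀^ℝ` of `ofRlfZWeak` is the natural map `Φ₀ → Φ₀^pf → Φ₀^rlf`. [cite: MochizukiEtTh2009, Def 3.6 p.76] -/
theorem ofRlfZWeak_toR (Y : D₀ᵒᵖ) :
    (ofRlfZWeak dm hpf).toR Y = ((toRlfNatTransWeak dm.Φ₀ hpf).app Y).hom := rfl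

/-- `Φ₀ → Φ₀^ℝ` of `ofRlfZWeak` on elements: `a ↦` the factorization of the image of `a` in `Φ₀(Y)^pf`.
[cite: MochizukiEtTh2009, Def 3.6 p.76] -/
theorem ofRlfZWeak_toR_apply (Y : D₀ᵒᵖ) (a : dm.Φ₀.obj Y) :
    (ofRlfZWeak dm hpf).toR Y a = (hpf Y).weak.toRealification (Perfection.of _ a) := rfl

/-- `B₀^ℤ := B₀`. [cite: MochizukiEtTh2009, Def 3.6 p.76] -/
@[simp] theorem ofRlfZWeak_BΛ : (ofRlfZWeak dm hpf).BΛ = dm.B₀ := rfl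

/-- `F₀^ℤ := F₀`. [cite: MochizukiEtTh2009, Def 3.6 p.76] -/
@[simp] theorem ofRlfZWeak_FΛ (Y : D₀ᵒᵖ) : (ofRlfZWeak dm hpf).FΛ Y = dm.F₀ Y := rfl

/-- `B₀^ℤ → (Φ₀^ℝ)^gp` of `ofRlfZWeak` is `ι ∘ (B₀ → Φ₀^gp)`. [cite: MochizukiEtTh2009, Def 3.6 p.76] -/
theorem ofRlfZWeak_divΛ_apply (Y : D₀ᵒᵖ) (b : dm.B₀.obj Y) :
    (ofRlfZWeak dm hpf).divΛ Y b = gpMap ((toRlfNatTransWeak dm.Φ₀ hpf).app Y).hom (dm.div₀ Y b) := rfl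

/-- `ℝ·Φ₀^cnst` of `ofRlfZWeak` is the `ℝ`-span of `Φ₀^cnst` in `(Φ₀^rlf)^gp` (THE weak realification data).
[cite: MochizukiEtTh2009, Def 3.6 p.76] -/
theorem ofRlfZWeak_cnstR (Y : D₀ᵒᵖ) :
    (ofRlfZWeak dm hpf).cnstR Y = ((realDataWeak dm hpf).realSpan dm.cnstGp).carrier (unop Y) := rfl

/-- `ℝ·Φ₀^cnst` of `ofRlfZWeak` is an `ℝ`-subspace: stable under the `ℝ`-action of `(Φ₀^rlf)^gp`.
[cite: MochizukiEtTh2009, Def 3.6 p.76] -/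
theorem ofRlfZWeak_rsmul_mem_cnstR (Y : D₀ᵒᵖ) (s : ℝ)
    {x : Algebra.GrothendieckGroup ((rlfFunctorWeak dm.Φ₀ hpf).obj Y)}
    (hx : x ∈ (ofRlfZWeak dm hpf).cnstR Y) :
    (realDataWeak dm hpf).rsmul (unop Y) s x ∈ (ofRlfZWeak dm hpf).cnstR Y :=
  RealificationDataLemmas.rsmul_mem_realSpan _ _ (unop Y) s hx

/-- Membership in the non-cuspidal part of `Φ₀^ℝ(Y)` of `ofRlfZWeak`: support inside the primes arising
from the non-cuspidal log-divisors. [cite: MochizukiEtTh2009, Def 3.6 p.77] -/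
theorem mem_ofRlfZWeak_ncspR_iff (Y : D₀ᵒᵖ) (x : (hpf Y).weak.Rlf) :
    x ∈ (ofRlfZWeak dm hpf).ncspR Y ↔
      supp (x : RlfFactor (dm.Φ₀.obj Y)) ⊆ toRSuppOfWeak dm hpf Y (dm.ncsp₀ Y) :=
  Iff.rfl

/-- Membership in the cuspidal part of `Φ₀^ℝ(Y)` of `ofRlfZWeak`: support inside the primes arising from
the cuspidal log-divisors. [cite: MochizukiEtTh2009, Def 3.6 p.77] -/
theorem mem_ofRlfZWeak_cspR_iff (Y : D₀ᵒᵖ) (x : (hpf Y).weak.Rlf) :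
    x ∈ (ofRlfZWeak dm hpf).cspR Y ↔
      supp (x : RlfFactor (dm.Φ₀.obj Y)) ⊆ toRSuppOfWeak dm hpf Y (dm.csp₀ Y) :=
  Iff.rfl

/-! ### The monoid type `Λ = ℝ` -/

/-- **Definition 3.6 (i) for the monoid type `Λ = ℝ` over the WEAK vocabulary, CONSTRUCTED**: as
`ofRlfZWeak`, but with `B₀^ℝ := ℝ·Φ₀^birat ⊆ (Φ₀^ℝ)^gp` (the `ℝ`-span of `Φ₀^birat`, a group-like monoid on
`D₀` with its inclusion as `B₀^ℝ → (Φ₀^ℝ)^gp`) and `F₀^ℝ := ℝ·Φ₀^cnst` (as a submonoid of `B₀^ℝ`); every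
axiom of the interface is proved. [cite: MochizukiEtTh2009, Def 3.6 p.76] -/
def ofRlfRWeak : RealifiedDivisorMonoids (D₀ := D₀) treeMonoidVocabWeak.{w} where
  toDivisorMonoids := dm
  Λ := MonoidType.R
  ΦR := rlfFunctorWeak dm.Φ₀ hpf
  toR Y := ((toRlfNatTransWeak dm.Φ₀ hpf).app Y).hom
  toR_natural f x := (rlfMapWeak_toRealification_of dm.Φ₀ hpf f x).symm
  isRealification Y := isRealificationViaWeak_toRealification (hpf Y).weak
  BΛ := ((realDataWeak dm hpf).realSpan dm.biratGp).toMonoid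
  isUnit_BΛ Y b := ((realDataWeak dm hpf).realSpan dm.biratGp).isUnit_toMonoid Y b
  divΛ Y := (((realDataWeak dm hpf).realSpan dm.biratGp).incl.app Y).hom
  divΛ_natural {Y Y'} f b := by
    rw [gpMap_eq_monGpMap]
    rfl
  FΛ Y := ((realDataWeak dm hpf).realSpan dm.cnstGp).carrier (unop Y) |>.toSubmonoid.comap
    (((realDataWeak dm hpf).realSpan dm.biratGp).carrier (unop Y)).subtype
  FΛ_map {Y Y'} f b hb := ((realDataWeak dm hpf).realSpan dm.cnstGp).pull_mem f.unop hb
  cnstR Y := ((realDataWeak dm hpf).realSpan dm.cnstGp).carrier (unop Y)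
  cnstR_map {Y Y'} f x hx := by
    have h := ((realDataWeak dm hpf).realSpan dm.cnstGp).pull_mem f.unop hx
    rwa [pullGp, ← gpMap_eq_monGpMap] at h
  divΛ_mem_cnstR Y b hb := hb
  cnstR_root Y g n hg := RealificationDataLemmas.mem_realSpan_of_pow_mem _ _ (unop Y) n.pos hg
  cnst_le_cnstR Y b hb := by
    change gpMap ((toRlfNatTransWeak dm.Φ₀ hpf).app Y).hom (dm.div₀ Y b) ∈
      ((realDataWeak dm hpf).realSpan dm.cnstGp).carrier (unop Y)
    rw [← toRlfGp_realDataWeak_eq]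
    exact (realDataWeak dm hpf).toRlfGp_mem_realSpan dm.cnstGp (unop Y)
      (dm.mem_cnstGp_of_mem_cnst (unop Y) ⟨b, hb, rfl⟩)
  ncspR Y := rlfSuppInWeak (hpf Y).weak (toRSuppOfWeak dm hpf Y (dm.ncsp₀ Y))
  cspR Y := rlfSuppInWeak (hpf Y).weak (toRSuppOfWeak dm hpf Y (dm.csp₀ Y))
  toR_ncsp Y x hx := supp_toR_subset_toRSuppOfWeak dm hpf Y hx
  toR_csp Y x hx := supp_toR_subset_toRSuppOfWeak dm hpf Y hx

/-- The monoid type of `ofRlfRWeak` is `ℝ`. [cite: MochizukiEtTh2009, Def 3.6 p.76] -/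
@[simp] theorem ofRlfRWeak_Λ : (ofRlfRWeak dm hpf).Λ = MonoidType.R := rfl

/-- `Φ₀^ℝ` of `ofRlfRWeak` is the weak realification functor. [cite: MochizukiEtTh2009, Def 3.6 p.76] -/
@[simp] theorem ofRlfRWeak_ΦR : (ofRlfRWeak dm hpf).ΦR = rlfFunctorWeak dm.Φ₀ hpf := rfl

/-- `B₀^ℝ := ℝ·Φ₀^birat` as a monoid on `D₀`. [cite: MochizukiEtTh2009, Def 3.6 p.76] -/
theorem ofRlfRWeak_BΛ : (ofRlfRWeak dm hpf).BΛ = ((realDataWeak dm hpf).realSpan dm.biratGp).toMonoid := rfl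

/-- `ℝ·Φ₀^cnst` of `ofRlfRWeak` agrees with that of `ofRlfZWeak` (the `ℝ`-span of `Φ₀^cnst`).
[cite: MochizukiEtTh2009, Def 3.6 p.76] -/
theorem ofRlfRWeak_cnstR (Y : D₀ᵒᵖ) : (ofRlfRWeak dm hpf).cnstR Y = (ofRlfZWeak dm hpf).cnstR Y := rfl

/-- `ℝ·Φ₀^cnst ⊆ ℝ·Φ₀^birat = B₀^ℝ` for the weak data (spans are monotone). [cite: MochizukiEtTh2009, Def 3.6 p.76] -/
theorem ofRlfRWeak_cnstR_le_realSpan_biratGp (Y : D₀ᵒᵖ) :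
    (ofRlfRWeak dm hpf).cnstR Y ≤ ((realDataWeak dm hpf).realSpan dm.biratGp).carrier (unop Y) :=
  RealificationDataLemmas.realSpan_mono _ (unop Y) (dm.cnstGp_le_biratGp (unop Y))

/-- The data `ofRlfRWeak` and `ofRlfZWeak` share the Def. 3.3 (iii) part and the realification block
(only `Λ`, `B₀^Λ`, `F₀^Λ` differ). [cite: MochizukiEtTh2009, Def 3.6 p.76] -/
theorem ofRlfRWeak_toDivisorMonoids :
    (ofRlfRWeak dm hpf).toDivisorMonoids = (ofRlfZWeak dm hpf).toDivisorMonoids := rfl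

/-! ### From the typed Proposition 3.4 over the weak vocabulary -/

/-- **Def. 3.6 (i) (`Λ = ℤ`) CONSTRUCTED from Def. 3.3 (iii) data satisfying abc-iut-L2-t3's typed
Proposition 3.4 over the WEAK vocabulary** (`dm.Prop34 treeMonoidVocabWeak V₀`, whose clause (i)
"`Φ₀(Y^log)` is perf-factorial" READS `IsPerfFactorialCof`, by `Iff.rfl`): the hypothesis `hpf` of
`ofRlfZWeak` is exactly Prop. 3.4 (i). [cite: MochizukiEtTh2009, Prop 3.4 p.74] -/
abbrev ofRlfZWeakOfProp34 {V₀ : FrdICatStub.{u, v, w} D₀} (h34 : dm.Prop34 treeMonoidVocabWeak.{w} V₀) :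
    RealifiedDivisorMonoids (D₀ := D₀) treeMonoidVocabWeak.{w} :=
  ofRlfZWeak dm h34.isPerfFactorial

/-- The same for `Λ = ℝ`. [cite: MochizukiEtTh2009, Prop 3.4 p.74] -/
abbrev ofRlfRWeakOfProp34 {V₀ : FrdICatStub.{u, v, w} D₀} (h34 : dm.Prop34 treeMonoidVocabWeak.{w} V₀) :
    RealifiedDivisorMonoids (D₀ := D₀) treeMonoidVocabWeak.{w} :=
  ofRlfRWeak dm h34.isPerfFactorial

/-- `ofRlfZWeakOfProp34` keeps the Def. 3.3 (iii) data. [cite: MochizukiEtTh2009, Def 3.6 p.76] -/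
theorem ofRlfZWeakOfProp34_toDivisorMonoids {V₀ : FrdICatStub.{u, v, w} D₀}
    (h34 : dm.Prop34 treeMonoidVocabWeak.{w} V₀) :
    (ofRlfZWeakOfProp34 dm h34).toDivisorMonoids = dm := rfl

/-- `Φ₀ → Φ₀^ℝ` of `ofRlfRWeak` is the same natural map `Φ₀ → Φ₀^pf → Φ₀^rlf` as for `ofRlfZWeak` (Def. 3.6
(i): the realified divisor monoid `Φ₀^ℝ` does not depend on `Λ`).  (Append 2026-08-26 by seat abc-iut-L2-d2,
API parity with `ofRlfZWeak_toR` / `ofRlfZWeak_toR_apply`; prefix byte-identical.)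
[cite: MochizukiEtTh2009, Def 3.6 p.76] -/
theorem ofRlfRWeak_toR (Y : D₀ᵒᵖ) : (ofRlfRWeak dm hpf).toR Y = (ofRlfZWeak dm hpf).toR Y := rfl

/-- `Φ₀ → Φ₀^ℝ` of `ofRlfRWeak` on elements: `a ↦` the factorization of the image of `a` in `Φ₀(Y)^pf`.
[cite: MochizukiEtTh2009, Def 3.6 p.76] -/
theorem ofRlfRWeak_toR_apply (Y : D₀ᵒᵖ) (a : dm.Φ₀.obj Y) :
    (ofRlfRWeak dm hpf).toR Y a = (hpf Y).weak.toRealification (Perfection.of _ a) := rfl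

end RealifiedDivisorMonoids

end Literature.AnabelianGeometry.EtaleTheta

end
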